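import Literature.Analysis.FunctionSpaces.TorusCommutatorEstimate
import HarnessLib

/-!
# Mollification on `T^d` in Hölder classes: sup-norm forms of the Constantin–E–Titi estimates

Analysis/FunctionSpaces support file (serves the discharge of the Obukhov–Corrsin threshold,
`Literature.Barriers.AnomalousDissipation.DrivasElgindiIyerJeong2022_thm4`,
`Barriers/AnomalousDissipation/ObukhovCorrsinThreshold`; Drivas–Elgindi–Iyer–Jeong 2022, proof of
Thm. 4, the displayed "standard estimates for mollified gradients and the Constantin–E–Titi
commutator estimate" `|∇f̄_ℓ|_∞ ≤ [f]_α ℓ^{α-1}`, `|τ_ℓ(f,g)|_∞ ≤ C [f]_α [g]_β ℓ^{α+β}`).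
For the standard mollifier `k_ε = Torus.kernel ε` on the flat torus (`TorusMollifier`,
`TorusConvolution`, `TorusMollifierEstimates`; mollification `θ ⋆ k_ε` with the rough factor on
the left) and Hölder functions `f ∈ C^a`, `g ∈ C^b` (Mathlib's `HolderWith C r f` for the
intrinsic sup metric of `UnitAddTorus d`), we prove the pointwise (sup-norm) bounds

* `Torus.abs_sub_le_of_holderWith` — `|f(x - y) - f(x)| ≤ C ‖y‖^a`;
* `Torus.abs_integral_kernel_mul_le` — kernel averages: `|∫ k_ε h| ≤ M` if `|h| ≤ M` on `{‖y‖ < ε}`;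
* `Torus.abs_convolution_kernel_sub_self_le` — CET (6), sup form: `|(f ⋆ k_ε)(x) - f(x)| ≤ C ε^a`;
* `Torus.abs_partialDeriv_convolution_kernel_le` — CET (7), sup form:
  `|∂ⱼ(f ⋆ k_ε)(x)| ≤ (C₁/ε) C ε^a`, `C₁ = Torus.gradProfileMass`;
* `Torus.abs_commutatorRemainder_le`, `Torus.abs_commutator_le` — CET (9)–(10), sup form:
  `|r_ε(f,g)(x)| ≤ C_f ε^a C_g ε^b` and
  `|((fg) ⋆ k_ε)(x) - (f ⋆ k_ε)(x) (g ⋆ k_ε)(x)| ≤ 2 C_f ε^a C_g ε^b`;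
* `Torus.integral_sq_sub_integral_convolution_sq_le` — the integrated scalar cumulant
  `∫ f² - ∫ (f ⋆ k_ε)² = ∫ τ_ε(f,f) ≤ (C_f ε^b)²` (DEIJ 2022, proof of Thm. 4: the term
  `½∫τ_ℓ(θ,θ)` with `τ_ℓ(f,f) ≥ 0`).

## Mathlib / tree search

Mathlib (this pin): `HolderWith.dist_le`, `PiLp.edist_apply_le`, `norm_integral_le_of_norm_le`,
`MeasureTheory.integral_convolution`; no mollifier estimates in Hölder classes (searched
`HolderWith` + `convolution`: none). Tree: the `Lᵖ`-modulus forms CET (6)–(7) are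
`Torus.eLpNorm_convolution_kernel_sub_self_le`, `Torus.eLpNorm_partialDeriv_convolution_kernel_le`
(`TorusMollifierEstimates`) and the `L^{3/2}` remainder bound `Torus.eLpNorm_commutatorRemainder_le`
(`TorusCommutatorEstimate`); the sup-norm forms here are their elementary `p = ∞` analogues, read
off the kernel-average formulas `Torus.convolution_kernel_sub_self_apply`,
`Torus.partialDeriv_convolution_kernel_apply`, `Torus.convolution_mul_sub_mul_convolution`.

## References

* P. Constantin, W. E, E. S. Titi, *Onsager's conjecture on the energy conservation for solutions
  of Euler's equation*, Comm. Math. Phys. 165 (1994), 207–209, (6), (7), (9), (10).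
* T. D. Drivas, T. M. Elgindi, G. Iyer, I.-J. Jeong, *Anomalous dissipation in passive scalar
  transport*, Arch. Ration. Mech. Anal. 243 (2022), 1151–1180 (arXiv:1911.03271), proof of Thm. 4.
-/

noncomputable section

open MeasureTheory TopologicalSpace Set Function Filter Metric ContinuousLinearMap
open scoped ENNReal NNReal Convolution

namespace Literature.Analysis.FunctionSpaces

namespace Torus

variable {d : Type*} [Fintype d] {ε : ℝ}

/-! ## Hölder increments -/

section Increments

/-- A Hölder function has increments `|f(x - y) - f(x)| ≤ C ‖y‖^r` (the distance on `T^d` is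
translation invariant: `dist (x - y) x = ‖y‖`). [folklore] -/
theorem abs_sub_le_of_holderWith {f : UnitAddTorus d → ℝ} {C r : ℝ≥0} (hf : HolderWith C r f)
    (x y : UnitAddTorus d) : |f (x - y) - f x| ≤ C * ‖y‖ ^ (r : ℝ) := by
  have h := hf.dist_le (x - y) x
  rwa [Real.dist_eq, dist_eq_norm, sub_sub_cancel_left, norm_neg] at h

/-- Hölder increments at scale `ε`: `|f(x - y) - f(x)| ≤ C ε^r` for `‖y‖ ≤ ε`. [folklore] -/
theorem abs_sub_le_of_holderWith_of_norm_le {f : UnitAddTorus d → ℝ} {C r : ℝ≥0}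
    (hf : HolderWith C r f) (x : UnitAddTorus d) {y : UnitAddTorus d} (hy : ‖y‖ ≤ ε) :
    |f (x - y) - f x| ≤ C * ε ^ (r : ℝ) :=
  (abs_sub_le_of_holderWith hf x y).trans
    (mul_le_mul_of_nonneg_left (Real.rpow_le_rpow (norm_nonneg _) hy r.2) C.2)

/-- The coordinates of a Hölder vector field are Hölder with the same constant (coordinates of
`EuclideanSpace` are `1`-Lipschitz, `PiLp.edist_apply_le`). [folklore] -/
theorem holderWith_apply {ι : Type*} [Fintype ι] {v : UnitAddTorus d → EuclideanSpace ℝ ι}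
    {C r : ℝ≥0} (hv : HolderWith C r v) (j : ι) : HolderWith C r fun y => v y j :=
  fun a b => (PiLp.edist_apply_le (v a) (v b) j).trans (hv a b)

/-- From a bound on the Hölder seminorm to a Hölder constant: if `f ∈ C^r` and
`nnHolderNorm r f ≤ C` then `f` is `r`-Hölder with constant `C`. [folklore] -/
theorem holderWith_of_nnHolderNorm_le {Y : Type*} [NormedAddCommGroup Y] {f : UnitAddTorus d → Y}
    {C r : ℝ≥0} (hf : MemHolder r f) (hC : nnHolderNorm r f ≤ C) : HolderWith C r f :=
  fun a b => (hf.holderWith a b).trans (by gcongr)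

end Increments

/-! ## Kernel averages of bounded functions -/

section KernelAverage

/-- **Averages against the unit-mass kernel**: if `|h(y)| ≤ M` whenever `‖y‖ < ε`, then
`|∫ k_ε(y) h(y) dy| ≤ M` (`k_ε ≥ 0`, `∫ k_ε = 1`, `supp k_ε ⊆ {‖y‖ < ε}`; no measurability of
`h` is needed, the Bochner integral of a non-integrable function being `0 ≤ M`). [folklore] -/
theorem abs_integral_kernel_mul_le (hε : 0 < ε) (hε' : ε ≤ 1 / 4) {h : UnitAddTorus d → ℝ}
    {M : ℝ} (hM : ∀ y : UnitAddTorus d, ‖y‖ < ε → |h y| ≤ M) :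
    |∫ y, kernel ε y * h y| ≤ M := by
  have hk := continuous_kernel (d := d) hε hε'
  have hbound : ∀ y : UnitAddTorus d, ‖kernel ε y * h y‖ ≤ kernel ε y * M := by
    intro y
    rw [norm_mul, Real.norm_eq_abs, Real.norm_eq_abs, abs_of_nonneg (kernel_nonneg hε.le y)]
    by_cases hky : kernel ε y = 0
    · simp [hky]
    · exact mul_le_mul_of_nonneg_left
        (hM y (mem_ball_zero_iff.1 (support_kernel_subset hε hky))) (kernel_nonneg hε.le y)
  have h := norm_integral_le_of_norm_le ((hk.integrable_unitAddTorus).mul_const M)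
    (Eventually.of_forall hbound)
  rw [Real.norm_eq_abs, integral_mul_const, integral_kernel hε hε', one_mul] at h
  exact h

/-- **Averages against the gradient of the kernel**: if `|h(y)| ≤ M` whenever `‖y‖ ≤ ε`, then
`|∫ ∂ⱼk_ε(y) h(y) dy| ≤ (C₁/ε) M` (`|∂ⱼk_ε| ≤ ‖∇k_ε‖`, `∫ ‖∇k_ε‖ = C₁/ε`, and `∇k_ε` vanishes
off `{‖y‖ ≤ ε}`). [folklore] -/
theorem abs_integral_partialDeriv_kernel_mul_le [DecidableEq d] (hε : 0 < ε) (hε' : ε ≤ 1 / 4)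
    (j : d) {h : UnitAddTorus d → ℝ} {M : ℝ} (hM : ∀ y : UnitAddTorus d, ‖y‖ ≤ ε → |h y| ≤ M) :
    |∫ y, partialDeriv j (kernel ε) y * h y| ≤ ε⁻¹ * gradProfileMass d * M := by
  have hk := isSmooth_kernel (d := d) hε hε'
  have hk1 : IsContDiff 1 (kernel (d := d) ε) := hk.isContDiff (by simp)
  have hbound : ∀ y : UnitAddTorus d,
      ‖partialDeriv j (kernel ε) y * h y‖ ≤ ‖Torus.gradient (kernel ε) y‖ * M := by
    intro y
    rw [norm_mul, Real.norm_eq_abs, Real.norm_eq_abs]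
    have hpj := abs_partialDeriv_le_norm_gradient hk1 y j
    by_cases hgy : Torus.gradient (kernel ε) y = 0
    · rw [hgy, norm_zero] at hpj ⊢
      rw [le_antisymm hpj (abs_nonneg _), zero_mul, zero_mul]
    · have hy := norm_le_of_gradient_kernel_ne_zero hε hε' hgy
      have hM0 : 0 ≤ M := (abs_nonneg _).trans (hM y hy)
      exact mul_le_mul hpj (hM y hy) (abs_nonneg _) (norm_nonneg _)
  have h := norm_integral_le_of_norm_le
    (((continuous_gradient_kernel hε hε').norm.integrable_unitAddTorus).mul_const M)
    (Eventually.of_forall hbound)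
  rw [Real.norm_eq_abs, integral_mul_const, integral_norm_gradient_kernel hε hε'] at h
  exact h

end KernelAverage

/-! ## CET (6) and (7) in sup norm -/

section SupEstimates

/-- **CET (6), sup form**: for `f` integrable and `r`-Hölder with constant `C`,
`|(f ⋆ k_ε)(x) - f(x)| ≤ C ε^r` (`(f ⋆ k_ε)(x) - f(x) = ∫ k_ε(y) (f(x-y) - f(x)) dy`;
Constantin–E–Titi 1994, (6); DEIJ 2022, proof of Thm. 4). [cite: ConstantinETiti1994, (6)] -/
theorem abs_convolution_kernel_sub_self_le {f : UnitAddTorus d → ℝ} (hfi : Integrable f volume)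
    {C r : ℝ≥0} (hf : HolderWith C r f) (hε : 0 < ε) (hε' : ε ≤ 1 / 4) (x : UnitAddTorus d) :
    |(f ⋆ kernel ε) x - f x| ≤ C * ε ^ (r : ℝ) := by
  rw [convolution_kernel_sub_self_apply hfi hε hε' x]
  simp only [smul_eq_mul]
  exact abs_integral_kernel_mul_le hε hε' fun y hy =>
    abs_sub_le_of_holderWith_of_norm_le hf x hy.le

/-- **CET (7), sup form** ("standard estimates for mollified gradients",
`|∇f̄_ℓ|_∞ ≤ [f]_α ℓ^{α-1}`): for `f` integrable and `r`-Hölder with constant `C`,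
`|∂ⱼ(f ⋆ k_ε)(x)| ≤ (C₁/ε) C ε^r` (`∂ⱼ(f ⋆ k_ε)(x) = ∫ ∂ⱼk_ε(y) (f(x-y) - f(x)) dy`;
Constantin–E–Titi 1994, (7); DEIJ 2022, proof of Thm. 4). [cite: ConstantinETiti1994, (7)] -/
theorem abs_partialDeriv_convolution_kernel_le [DecidableEq d] {f : UnitAddTorus d → ℝ}
    (hfi : Integrable f volume) {C r : ℝ≥0} (hf : HolderWith C r f) (hε : 0 < ε) (hε' : ε ≤ 1 / 4)
    (j : d) (x : UnitAddTorus d) :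
    |partialDeriv j (f ⋆ kernel ε) x| ≤ ε⁻¹ * gradProfileMass d * (C * ε ^ (r : ℝ)) := by
  rw [partialDeriv_convolution_kernel_apply hfi hε hε' j x]
  simp only [smul_eq_mul]
  exact abs_integral_partialDeriv_kernel_mul_le hε hε' j fun y hy =>
    abs_sub_le_of_holderWith_of_norm_le hf x hy

end SupEstimates

/-! ## CET (9)–(10) in sup norm -/

section Commutator

/-- **The remainder `r_ε(f,g)` is small in sup norm**: for `f ∈ C^a`, `g ∈ C^b` with constants
`C_f`, `C_g`, `|∫ k_ε(y) (f(x-y) - f(x)) (g(x-y) - g(x)) dy| ≤ (C_f ε^a) (C_g ε^b)`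
(Constantin–E–Titi 1994, (9); DEIJ 2022, proof of Thm. 4, `|τ_ℓ(f,g)|_∞ ≲ ℓ^{α+β}`). [cite: ConstantinETiti1994, (9)] -/
theorem abs_commutatorRemainder_le {f g : UnitAddTorus d → ℝ} {Cf a Cg b : ℝ≥0}
    (hf : HolderWith Cf a f) (hg : HolderWith Cg b g) (hε : 0 < ε) (hε' : ε ≤ 1 / 4)
    (x : UnitAddTorus d) :
    |∫ y, kernel ε y * ((f (x - y) - f x) * (g (x - y) - g x))| ≤
      Cf * ε ^ (a : ℝ) * (Cg * ε ^ (b : ℝ)) := by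
  refine abs_integral_kernel_mul_le hε hε' fun y hy => ?_
  rw [abs_mul]
  exact mul_le_mul (abs_sub_le_of_holderWith_of_norm_le hf x hy.le)
    (abs_sub_le_of_holderWith_of_norm_le hg x hy.le) (abs_nonneg _) (by positivity)

/-- **The Constantin–E–Titi commutator estimate in Hölder classes** (sup form of CET (10)–(11);
DEIJ 2022, proof of Thm. 4: `|τ_ℓ(f,g)|_{L^∞} ≤ C [f]_{C^α} [g]_{C^β} ℓ^{α+β}`): for integrable
`f ∈ C^a`, `g ∈ C^b` with `fg` integrable,
`|((fg) ⋆ k_ε)(x) - (f ⋆ k_ε)(x) (g ⋆ k_ε)(x)| ≤ 2 (C_f ε^a) (C_g ε^b)`. [cite: DrivasEtAl2022, proof of Thm. 4] -/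
theorem abs_commutator_le {f g : UnitAddTorus d → ℝ} (hfi : Integrable f volume)
    (hgi : Integrable g volume) (hfg : Integrable (fun x => f x * g x) volume) {Cf a Cg b : ℝ≥0}
    (hf : HolderWith Cf a f) (hg : HolderWith Cg b g) (hε : 0 < ε) (hε' : ε ≤ 1 / 4)
    (x : UnitAddTorus d) :
    |((fun y => f y * g y) ⋆ kernel ε) x - (f ⋆ kernel ε) x * (g ⋆ kernel ε) x| ≤
      2 * (Cf * ε ^ (a : ℝ) * (Cg * ε ^ (b : ℝ))) := by
  rw [convolution_mul_sub_mul_convolution hfi hgi hfg hε hε' x]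
  have h1 := abs_commutatorRemainder_le hf hg hε hε' x
  have h2 : |(f x - (f ⋆ kernel ε) x) * (g x - (g ⋆ kernel ε) x)| ≤
      Cf * ε ^ (a : ℝ) * (Cg * ε ^ (b : ℝ)) := by
    rw [abs_mul, abs_sub_comm (f x), abs_sub_comm (g x)]
    exact mul_le_mul (abs_convolution_kernel_sub_self_le hfi hf hε hε' x)
      (abs_convolution_kernel_sub_self_le hgi hg hε hε' x) (abs_nonneg _) (by positivity)
  calc _ ≤ |∫ y, kernel ε y * ((f (x - y) - f x) * (g (x - y) - g x))| +
        |(f x - (f ⋆ kernel ε) x) * (g x - (g ⋆ kernel ε) x)| := abs_sub _ _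
    _ ≤ _ := by linarith

/-- **The integrated scalar cumulant is small** (DEIJ 2022, proof of Thm. 4, the term
`½ ∫ τ_ℓ(θ,θ) dx` with `τ_ℓ(f,f) = (f²)_ℓ - f_ℓ² ≥ 0`): for continuous `f ∈ C^b` with constant
`C_f`, `∫ f² - ∫ (f ⋆ k_ε)² ≤ (C_f ε^b)²` (`∫ f² = ∫ (f²) ⋆ k_ε` by unit mass, the CET identity
pointwise, and `τ_ε(f,f) = r_ε(f,f) - (f - f ⋆ k_ε)² ≤ r_ε(f,f)`). [cite: DrivasEtAl2022, proof of Thm. 4] -/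
theorem integral_sq_sub_integral_convolution_sq_le {f : UnitAddTorus d → ℝ} (hfc : Continuous f)
    {Cf b : ℝ≥0} (hf : HolderWith Cf b f) (hε : 0 < ε) (hε' : ε ≤ 1 / 4) :
    (∫ x, f x ^ 2) - ∫ x, (f ⋆ kernel ε) x ^ 2 ≤ (Cf * ε ^ (b : ℝ)) ^ 2 := by
  have hk := isSmooth_kernel (d := d) hε hε'
  have hfi : Integrable f volume := hfc.integrable_unitAddTorus
  have hff : Integrable (fun x => f x * f x) volume := (hfc.mul hfc).integrable_unitAddTorus
  -- `∫ f² = ∫ (f²) ⋆ k`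
  have hmass : ∫ x, f x ^ 2 = ∫ x, ((fun y => f y * f y) ⋆ kernel ε) x := by
    rw [integral_convolution (lsmul ℝ ℝ) hff hk.continuous.integrable_unitAddTorus, lsmul_apply,
      integral_kernel hε hε', smul_eq_mul, mul_one]
    exact integral_congr_ae (Eventually.of_forall fun x => sq (f x))
  have hA : Continuous (f ⋆ kernel ε) := continuous_convolution hfi hk.continuous
  have hB : Continuous ((fun y => f y * f y) ⋆ kernel ε) := continuous_convolution hff hk.continuous
  have hA2 : Integrable (fun x => (f ⋆ kernel ε) x ^ 2) volume :=
    (hA.pow 2 : Continuous fun x => (f ⋆ kernel ε) x ^ 2).integrable_unitAddTorus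
  rw [hmass, ← integral_sub hB.integrable_unitAddTorus hA2]
  have hpt : ∀ x, ((fun y => f y * f y) ⋆ kernel ε) x - (f ⋆ kernel ε) x ^ 2 ≤ (Cf * ε ^ (b : ℝ)) ^ 2 := by
    intro x
    have hcet := convolution_mul_sub_mul_convolution hfi hfi hff hε hε' x
    rw [sq, hcet, sq]
    have hr := (le_abs_self _).trans (abs_commutatorRemainder_le hf hf hε hε' x)
    nlinarith [mul_self_nonneg (f x - (f ⋆ kernel ε) x)]
  calc ∫ x, (((fun y => f y * f y) ⋆ kernel ε) x - (f ⋆ kernel ε) x ^ 2)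
      ≤ ∫ _x : UnitAddTorus d, (Cf * ε ^ (b : ℝ)) ^ 2 :=
        integral_mono (hB.integrable_unitAddTorus.sub hA2) (integrable_const _) hpt
    _ = (Cf * ε ^ (b : ℝ)) ^ 2 := by simp

end Commutator

end Torus

end Literature.Analysis.FunctionSpaces
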